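import Summits.AtomisticToContinuum.BoseEinsteinCondensation.Theses.BECTangentRigidity
import Summits.AtomisticToContinuum.BoseEinsteinCondensation.Theorems.BECTangentRigidityMesoscopicFloorStubCellPoincare
import Summits.AtomisticToContinuum.BoseEinsteinCondensation.Theorems.BECTangentRigidityMesoscopicFloorStubEnergyCeiling

/-!
# Route `BECTangentRigidity`, crux `MesoscopicFloor` (stmt-AtomisticToContinuum-13035) — closed

Settles the crux item `stmt-AtomisticToContinuum-13035` of route
`route-AtomisticToContinuum-BECTangentRigidity`: the route decl
`Summit.AtomisticToContinuum.BoseEinsteinCondensation.Theses.BECTangentRigidity.MesoscopicFloor`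
BY NAME (theorem `becTangentRigidity_mesoscopicFloor_proof`), along the registered line
`Lines/birth.lean` ("kinetic gap at the dyadic-cell scale").

The crux as typed asks, for every repulsive finite-range `v` at every small density `ρ`, for SOME
`N`-independent window `ℓ > 0` (chosen after `ρ`) such that, eventually in `N`, for some slack
`δ > 0`, every `δ`-near-minimiser `Ψ` of the Dirichlet `N`-body energy in the box of side
`L = (N/ρ)^{1/3}` has dyadic coherent sum `Σ_Q ⟨φ_Q, γ_Ψ φ_Q⟩ ≥ 7N/8` at every level `k` with cell
side `L/2^k ∈ [ℓ, 2ℓ)`.  Because the window is unpinned it may be taken below the healing length,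
where the kinetic gap of the cells does all the work:

* `MesoscopicFloor.stub_cellPoincare` (landed helper, `…StubCellPoincare.lean`): dyadic-cell Poincaré
  for bosonic Dirichlet trial states, `N ≤ cohSum N L k Ψ + C s² ∫|∇Ψ|²` (`C = π⁻²`; the tree's
  `BoseGas.key_inequality`, LSSY Ch. 5 (5.15)–(5.17));
* `MesoscopicFloor.stub_energyCeiling` (landed helper, `…StubEnergyCeiling.lean`): the a-priori bound
  `E₀^D(N, L_N) ≤ M N` eventually, at every density below the tree's dilute cap
  (`exists_density_cap_tendsto_e0`, LSSY (2.2), Ruelle §3.5.11);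
* this file: the bookkeeping `δ := 1`,
  `∫|∇Ψ|² ≤ energy v Ψ ≤ E₀ + 1 ≤ (M+1) N` (`N ≥ 1`), window `ℓ := min 1 (1/(32 C (M+1)))`, so that
  `C s² (M+1) N ≤ N/8` for every cell side `s < 2ℓ`, whence `N ≤ cohSum + N/8`, i.e.
  `cohSum ≥ 7N/8`; the hypothesis `ℓ ≤ s` of the crux is not needed.

Planner flag (from the refuter's crux attack, 2026-08-15, and the line card): the crux is true but
carries no Fournais-scale content as typed (unpinned window); pinning `ℓ² e₀(ρ) ≥ M` would be a
route edit, outside this file.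

## References

* [LSSY2005] E. H. Lieb, R. Seiringer, J. P. Solovej, J. Yngvason, *The Mathematics of the Bose Gas
  and its Condensation* (2005), §1.2 (1.16)–(1.19), Ch. 2 (2.2), Ch. 5 (5.15)–(5.17).
-/

noncomputable section

open MeasureTheory Filter
open scoped ENNReal NNReal

namespace Summit.AtomisticToContinuum.BoseEinsteinCondensation.Theorems

open Literature.MathematicalPhysics.QuantumManyBody.BoseGas

/-- **Item stmt-AtomisticToContinuum-13035** (`MesoscopicFloor` of route `BECTangentRigidity`, exact
route decl): for every repulsive finite-range `v`, at all small `ρ`, there is an `N`-independent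
`ℓ > 0` such that for all large `N`, some `δ > 0` and every `δ`-near-minimiser `Ψ`, every dyadic
level `k` with cell side `L/2^k ∈ [ℓ, 2ℓ)` has `Σ_(cells) ⟨φ_Q, γ_Ψ φ_Q⟩ ≥ 7N/8`.  Composition of the
two landed stubs of the registered line (`MesoscopicFloor.stub_cellPoincare`,
`MesoscopicFloor.stub_energyCeiling`); bookkeeping only: `δ := 1`;
`∫|∇Ψ|² ≤ energy v Ψ ≤ E₀ + 1 ≤ (M+1) N` for `N ≥ 1`; the window `ℓ := min 1 (1/(32 C (M+1)))`
makes `C s² (M+1) N ≤ N/8` for every cell side `s < 2ℓ`, so `N ≤ cohSum + N/8`, i.e.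
`cohSum ≥ 7N/8`; the hypothesis `ℓ ≤ s` of the crux is not needed.
[cite: LSSY2005, Ch. 5 (5.15)–(5.17)] -/
theorem becTangentRigidity_mesoscopicFloor_proof :
    Summit.AtomisticToContinuum.BoseEinsteinCondensation.Theses.BECTangentRigidity.MesoscopicFloor := by
  unfold Theses.BECTangentRigidity.MesoscopicFloor
  obtain ⟨C, hC, hP⟩ := MesoscopicFloor.stub_cellPoincare
  intro v hv
  obtain ⟨ρ₀, hρ₀, hρ⟩ := MesoscopicFloor.stub_energyCeiling v hv
  refine ⟨ρ₀, hρ₀, fun ρ hρpos hρlt => ?_⟩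
  obtain ⟨M, hM, hEv⟩ := hρ ρ hρpos hρlt
  -- the window `ℓ`: any `0 < ℓ ≤ 1` with `32 C (M+1) ℓ ≤ 1`
  have hA : (0 : ℝ) < 32 * C * (M + 1) := by positivity
  obtain ⟨ℓ, hℓpos, hℓ1, hℓ2⟩ : ∃ ℓ : ℝ, 0 < ℓ ∧ ℓ ≤ 1 ∧ ℓ * (32 * C * (M + 1)) ≤ 1 :=
    ⟨min 1 (1 / (32 * C * (M + 1))), lt_min one_pos (by positivity), min_le_left _ _,
      (le_div_iff₀ hA).1 (min_le_right _ _)⟩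
  refine ⟨ℓ, hℓpos, ?_⟩
  filter_upwards [hEv, eventually_ge_atTop 1] with N hEN hN1
  refine ⟨1, one_pos, fun Ψ hΨ k _hk1 hk2 => ?_⟩
  have hN1' : (1 : ℝ) ≤ N := by exact_mod_cast hN1
  have hLpos : 0 < sideLength ρ N := by
    unfold sideLength
    exact Real.rpow_pos_of_pos (div_pos (by linarith) hρpos) _
  have hs0 : 0 ≤ sideLength ρ N / 2 ^ k := by positivity
  -- kinetic energy ≤ total energy ≤ E₀ + 1 ≤ (M + 1) N
  have hT : ∫⁻ X, kineticDensity Ψ.ψ X ≤ ENNReal.ofReal ((M + 1) * N) := by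
    have h1 : (1 : ℝ≥0∞) ≤ ENNReal.ofReal (N : ℝ) := by
      rw [← ENNReal.ofReal_one]
      exact ENNReal.ofReal_le_ofReal hN1'
    calc ∫⁻ X, kineticDensity Ψ.ψ X ≤ energy v Ψ := by
          unfold energy
          exact lintegral_mono fun X => le_self_add
      _ ≤ groundStateEnergy v N (sideLength ρ N) + 1 := hΨ
      _ ≤ ENNReal.ofReal (M * N) + ENNReal.ofReal (N : ℝ) := add_le_add hEN h1
      _ = ENNReal.ofReal ((M + 1) * N) := by
          rw [← ENNReal.ofReal_add (by positivity) (by positivity)]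
          congr 1
          ring
  -- the real arithmetic: `C s² (M+1) N ≤ N/8` for `s < 2ℓ`
  have hCM : 0 ≤ C * (M + 1) := by positivity
  have hs2 : (sideLength ρ N / 2 ^ k) ^ 2 ≤ (2 * ℓ) ^ 2 := pow_le_pow_left₀ hs0 hk2.le 2
  have hℓsq : ℓ ^ 2 ≤ ℓ := by nlinarith
  have e1 := mul_le_mul_of_nonneg_right hs2 hCM
  have e2 := mul_le_mul_of_nonneg_right hℓsq hCM
  have hbound : C * (sideLength ρ N / 2 ^ k) ^ 2 * ((M + 1) * N) ≤ (N : ℝ) / 8 := by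
    have hsmall : C * (sideLength ρ N / 2 ^ k) ^ 2 * (M + 1) ≤ 1 / 8 := by
      have e3 : C * (sideLength ρ N / 2 ^ k) ^ 2 * (M + 1) =
          (sideLength ρ N / 2 ^ k) ^ 2 * (C * (M + 1)) := by ring
      rw [e3]
      nlinarith [e1, e2, hℓ2]
    calc C * (sideLength ρ N / 2 ^ k) ^ 2 * ((M + 1) * (N : ℝ))
        = (C * (sideLength ρ N / 2 ^ k) ^ 2 * (M + 1)) * (N : ℝ) := by ring
      _ ≤ (1 / 8 : ℝ) * (N : ℝ) := by gcongr
      _ = (N : ℝ) / 8 := by ring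
  -- Poincaré on the cells of level `k`, then absorb the kinetic term
  have hmain : ENNReal.ofReal (N : ℝ) ≤
      cohSum N (sideLength ρ N) k Ψ.ψ + ENNReal.ofReal ((N : ℝ) / 8) := by
    calc ENNReal.ofReal (N : ℝ)
        ≤ cohSum N (sideLength ρ N) k Ψ.ψ +
            ENNReal.ofReal (C * (sideLength ρ N / 2 ^ k) ^ 2) * ∫⁻ X, kineticDensity Ψ.ψ X :=
          hP N (sideLength ρ N) hLpos k Ψ
      _ ≤ cohSum N (sideLength ρ N) k Ψ.ψ +
            ENNReal.ofReal (C * (sideLength ρ N / 2 ^ k) ^ 2) * ENNReal.ofReal ((M + 1) * N) := by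
          gcongr
      _ = cohSum N (sideLength ρ N) k Ψ.ψ +
            ENNReal.ofReal (C * (sideLength ρ N / 2 ^ k) ^ 2 * ((M + 1) * N)) := by
          rw [← ENNReal.ofReal_mul (by positivity)]
      _ ≤ cohSum N (sideLength ρ N) k Ψ.ψ + ENNReal.ofReal ((N : ℝ) / 8) := by
          gcongr
  have hfin : ENNReal.ofReal (7 * (N : ℝ) / 8) ≤ cohSum N (sideLength ρ N) k Ψ.ψ := by
    have h78 : 7 * (N : ℝ) / 8 = N - N / 8 := by ring
    rw [h78, ENNReal.ofReal_sub _ (by positivity)]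
    exact tsub_le_iff_right.2 hmain
  simpa only [cohSum_eq] using hfin

end Summit.AtomisticToContinuum.BoseEinsteinCondensation.Theorems

end
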